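import Literature.Probability.Percolation.BlockResampling
import HarnessLib

/-!
# The `L²` form of the gluing bound: `‖𝟙_E - P_p(E | ω off B)‖₂² = ∫ Y(1 - Y) ≤ ε + ¼ P{ε < Y < 1 - ε}`

Topic `Literature/Probability/Percolation`; proofs-only companion of `BlockResampling.lean`.  In the
proof of Schramm–Smirnov's mesh-independent gluing (Prop. 4.1 of *On the scaling limits of planar
percolation*, Ann. Probab. 39 (2011), §4, "Setup" and "Final estimates") the discrete gluing
Theorem 1.1 enters through `Y₀ = 𝟙_{⊞_{Q₀}}`, `Y_s = P_η(⊞_{Q₀} | 𝓕_s)` and the `L²` bound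
"By (4.2) and the definition of `Y_s`, we can write `‖Y₀ - Y_s‖₂² < 2ε₀ + ε₀² < 3ε₀`".  For the
written-out conditional probability `Y = blockCondProb G p B E` this file proves the two facts
behind that sentence:

* `integral_sq_indicator_sub_blockCondProb` — `∫ (𝟙_E - Y)² dP_p = ∫ Y (1 - Y) dP_p`
  (`E[𝟙_E · a] = E[Y · a]` for functions `a` of the outside, `integral_outside_mul_eq`);
* `integral_blockCondProb_mul_one_sub_le` — `∫ Y(1 - Y) dP_p ≤ ε + ¼ · P_p{ε < Y < 1 - ε}` for
  `ε ≥ 0` (off the middle event `Y(1-Y) ≤ ε`, on it `≤ ¼`);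
* `integral_sq_indicator_sub_blockCondProb_le` — the combination.

## References

* O. Schramm, S. Smirnov, Ann. Probab. 39 (2011) 1768–1814, arXiv:1101.5820, §2 (proof of
  Thm. 1.1, last display) and §4 (proof of Prop. 4.1, "Final estimates"). [SchrammSmirnov2011]
-/

noncomputable section

open MeasureTheory ProbabilityTheory Set

namespace Literature.Probability.Percolation

variable {V : Type*} [Countable V] (G : SimpleGraph V) (p : unitInterval)

/-- **`‖𝟙_E - Y‖₂² = E[Y(1 - Y)]`** for `Y = P_p(E | ω off B)`: expanding the square,
`E[𝟙_E Y] = E[Y²]` and `E[𝟙_E] = E[Y]` by conditioning on the outside.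
[cite: SchrammSmirnov2011, proof of Prop. 4.1 ("‖Y₀ - Y_s‖₂² < 2ε₀ + ε₀²")] -/
theorem integral_sq_indicator_sub_blockCondProb (B : Finset (Sym2 V)) {E : Set (BondConfig V)}
    (hE : MeasurableSet E) :
    ∫ ω, (E.indicator (1 : BondConfig V → ℝ) ω - blockCondProb G p B E ω) ^ 2 ∂(bondPercolation G p) =
      ∫ ω, blockCondProb G p B E ω * (1 - blockCondProb G p B E ω) ∂(bondPercolation G p) := by
  set P := bondPercolation G p with hP
  set Y := blockCondProb G p B E with hY
  have hYm : Measurable Y := measurable_blockCondProb G p B hE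
  have hY01 : ∀ ω, 0 ≤ Y ω ∧ Y ω ≤ 1 := fun ω =>
    ⟨blockCondProb_nonneg G p B E ω, blockCondProb_le_one G p B E ω⟩
  have hIm : Measurable (E.indicator (1 : BondConfig V → ℝ)) := measurable_one.indicator hE
  have hI01 : ∀ ω, 0 ≤ E.indicator (1 : BondConfig V → ℝ) ω ∧ E.indicator (1 : BondConfig V → ℝ) ω ≤ 1 :=
    fun ω => ⟨Set.indicator_nonneg (fun _ _ => zero_le_one) ω,
      Set.indicator_apply_le' (fun _ => le_rfl) (fun _ => zero_le_one)⟩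
  -- conditioning on the outside with `a = 1 - 2Y` : `∫ (1 - 2Y) 𝟙_E = ∫ (1 - 2Y) Y`
  have hcond : ∫ ω, (1 - 2 * Y ω) * E.indicator (1 : BondConfig V → ℝ) ω ∂P =
      ∫ ω, (1 - 2 * Y ω) * Y ω ∂P := by
    rw [hP, integral_outside_mul_eq G p B (a := fun ω => 1 - 2 * Y ω)
      (measurable_const.sub (hYm.const_mul 2)) (Ka := 1)
      (fun ω => by have := hY01 ω; exact abs_le.2 ⟨by linarith, by linarith⟩)
      (fun ω ξ hξ => by
        show 1 - 2 * Y (ω \ ↑B ∪ ↑ξ) = 1 - 2 * Y ω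
        rw [hY, blockCondProb_sdiff_union G p B E ω hξ])
      (F := E.indicator 1) hIm (K := 1) (abs_indicator_one_le E)]
    rfl
  -- pointwise: `(𝟙 - Y)² = (1 - 2Y) 𝟙 + Y²` (`𝟙² = 𝟙`) and `Y(1-Y) = (1 - 2Y) Y + Y²`
  have hsq : ∀ ω, (E.indicator (1 : BondConfig V → ℝ) ω - Y ω) ^ 2 =
      (1 - 2 * Y ω) * E.indicator (1 : BondConfig V → ℝ) ω + Y ω ^ 2 := by
    intro ω
    have h1 : E.indicator (1 : BondConfig V → ℝ) ω ^ 2 = E.indicator (1 : BondConfig V → ℝ) ω := by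
      by_cases hω : ω ∈ E
      · rw [Set.indicator_of_mem hω, Pi.one_apply, one_pow]
      · rw [Set.indicator_of_notMem hω]; ring
    nlinarith [h1]
  have hsq' : ∀ ω, Y ω * (1 - Y ω) = (1 - 2 * Y ω) * Y ω + Y ω ^ 2 := fun ω => by ring
  have hint1 : Integrable (fun ω => (1 - 2 * Y ω) * E.indicator (1 : BondConfig V → ℝ) ω) P :=
    Integrable.of_bound ((measurable_const.sub (hYm.const_mul 2)).mul hIm).aestronglyMeasurable 1
      (ae_of_all _ fun ω => by
        have := hY01 ω; have := hI01 ω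
        rw [Real.norm_eq_abs, abs_le]; constructor <;> nlinarith)
  have hint2 : Integrable (fun ω => Y ω ^ 2) P :=
    Integrable.of_bound (hYm.pow_const 2).aestronglyMeasurable 1
      (ae_of_all _ fun ω => by
        have := hY01 ω
        rw [Real.norm_eq_abs, abs_le]; constructor <;> nlinarith)
  have hint3 : Integrable (fun ω => (1 - 2 * Y ω) * Y ω) P :=
    Integrable.of_bound ((measurable_const.sub (hYm.const_mul 2)).mul hYm).aestronglyMeasurable 1
      (ae_of_all _ fun ω => by
        have := hY01 ω
        rw [Real.norm_eq_abs, abs_le]; constructor <;> nlinarith)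
  simp_rw [hsq, hsq']
  rw [integral_add hint1 hint2, integral_add hint3 hint2, hcond]

/-- **`E[Y(1 - Y)] ≤ ε + ¼ P{ε < Y < 1 - ε}`** (`ε ≥ 0`): off the middle event `Y ≤ ε` or
`Y ≥ 1 - ε`, so `Y(1 - Y) ≤ ε`; on it `Y(1 - Y) ≤ ¼`. [cite: SchrammSmirnov2011, proof of Prop. 4.1 ("‖Y₀ - Y_s‖₂² < 2ε₀ + ε₀²")] -/
theorem integral_blockCondProb_mul_one_sub_le (B : Finset (Sym2 V)) {E : Set (BondConfig V)}
    (hE : MeasurableSet E) {ε : ℝ} (hε : 0 ≤ ε) :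
    ∫ ω, blockCondProb G p B E ω * (1 - blockCondProb G p B E ω) ∂(bondPercolation G p) ≤
      ε + 1 / 4 * (bondPercolation G p).real
        {ω | ε < blockCondProb G p B E ω ∧ blockCondProb G p B E ω < 1 - ε} := by
  set P := bondPercolation G p with hP
  set Y := blockCondProb G p B E with hY
  have hYm : Measurable Y := measurable_blockCondProb G p B hE
  set M : Set (BondConfig V) := {ω | ε < Y ω ∧ Y ω < 1 - ε} with hM
  have hMm : MeasurableSet M :=
    (measurableSet_lt measurable_const hYm).inter (measurableSet_lt hYm measurable_const)
  have hpt : ∀ ω, Y ω * (1 - Y ω) ≤ ε + M.indicator (fun _ => (1 / 4 : ℝ)) ω := by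
    intro ω
    have h0 := blockCondProb_nonneg G p B E ω
    have h1 := blockCondProb_le_one G p B E ω
    by_cases hω : ω ∈ M
    · rw [Set.indicator_of_mem hω]
      nlinarith [sq_nonneg (Y ω - 1 / 2)]
    · rw [Set.indicator_of_notMem hω, add_zero]
      have hω' : Y ω ≤ ε ∨ 1 - ε ≤ Y ω := by
        by_contra hcon
        push Not at hcon
        exact hω ⟨hcon.1, hcon.2⟩
      rcases hω' with h | h
      · show Y ω * (1 - Y ω) ≤ ε; nlinarith
      · show Y ω * (1 - Y ω) ≤ ε; nlinarith
  have hint : Integrable (fun ω => Y ω * (1 - Y ω)) P :=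
    Integrable.of_bound (hYm.mul (measurable_const.sub hYm)).aestronglyMeasurable 1
      (ae_of_all _ fun ω => by
        have h0 := blockCondProb_nonneg G p B E ω
        have h1 := blockCondProb_le_one G p B E ω
        rw [Real.norm_eq_abs, abs_le]; constructor <;> nlinarith)
  have hint' : Integrable (fun ω => ε + M.indicator (fun _ => (1 / 4 : ℝ)) ω) P :=
    (integrable_const ε).add ((integrable_const (1 / 4 : ℝ)).indicator hMm)
  calc ∫ ω, Y ω * (1 - Y ω) ∂P ≤ ∫ ω, (ε + M.indicator (fun _ => (1 / 4 : ℝ)) ω) ∂P :=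
        integral_mono hint hint' hpt
    _ = ε + 1 / 4 * P.real M := by
        rw [integral_add (integrable_const ε) ((integrable_const (1 / 4 : ℝ)).indicator hMm),
          integral_const, integral_indicator_const _ hMm, smul_eq_mul, smul_eq_mul, probReal_univ,
          one_mul, mul_comm]

/-- **The `L²` form of the gluing bound**: `‖𝟙_E - P_p(E | ω off B)‖₂² ≤ ε + ¼ P_p{ε < Y < 1 - ε}`
("we can write `‖Y₀ - Y_s‖₂² < 2ε₀ + ε₀² < 3ε₀`" once Theorem 1.1 makes the middle event small).
[cite: SchrammSmirnov2011, proof of Prop. 4.1 ("Final estimates")] -/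
theorem integral_sq_indicator_sub_blockCondProb_le (B : Finset (Sym2 V)) {E : Set (BondConfig V)}
    (hE : MeasurableSet E) {ε : ℝ} (hε : 0 ≤ ε) :
    ∫ ω, (E.indicator (1 : BondConfig V → ℝ) ω - blockCondProb G p B E ω) ^ 2 ∂(bondPercolation G p) ≤
      ε + 1 / 4 * (bondPercolation G p).real
        {ω | ε < blockCondProb G p B E ω ∧ blockCondProb G p B E ω < 1 - ε} := by
  rw [integral_sq_indicator_sub_blockCondProb G p B hE]
  exact integral_blockCondProb_mul_one_sub_le G p B hE hε

end Literature.Probability.Percolation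

end
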